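import Mathlib
import Literature.NumberTheory.LFunctions.Zhang2022.TypedSection12A
import Literature.NumberTheory.EllipticCurves.RootNumberTwistProofs
import HarnessLib

/-!
# Zhang (2022) §12 p. 67: the `𝔱`-sums (DAG `Z22:§12.u007`, `Z22:§12.u008`) — discharge and repair

Topic `Literature/NumberTheory/LFunctions/Zhang2022` (Landau–Siegel audit tree; verdict-neutral).
Y. Zhang, *Discrete mean estimates and the Landau–Siegel zero*, arXiv:2211.02515v1 (2022)
[Zhang2022LandauSiegel], §12 p. 67, tex L3415–L3423 — **an unrefereed manuscript under
adjudication** (campaign D-0069). THEOREMS ONLY (no new fact, no `def`), against the typed objects of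
`TypedSection12A` (`Typed.Sec12A.frakt`, `fraktN`, `fraktRow`, `fraktCol`, `FraktRowSmall`,
`FraktDoubleSum`, and the typer's PROVED `eq_of_frakt_mul_eq_one`).

`𝔱` is the indicator of `(P^{0.5}η₋, P^{0.5}η₊]`, `η_± = e^{±𝓛⁻¹⁰}`; write `A = P^{0.5}η₋`,
`B = P^{0.5}η₊`, `δ = B − A = P^{0.5}(η₊ − η₋)`.

* `sum_frakt_mul_div_le` — the one counting fact behind the page: for `c ≥ 1`,
  `Σ_{k≥1} 𝔱(ck)/k ≤ (B − A)/A + c/A` (the `k` with `𝔱(ck) = 1` lie in `(A/c, B/c]`, at most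
  `(B−A)/c + 1` of them, each with `1/k < c/A`).
* `fraktRowSmall_holds : FraktRowSmall` — **`Z22:§12.u007` is a theorem**: for
  `1 ≤ d ≤ P^{0.5}(η₊ − η₋)`, `Σ_l 𝔱(dl)/l ≤ 2(e^{2𝓛⁻¹⁰} − 1) ≤ 8𝓛⁻¹⁰`.
* `sum_inv_sq_mul_fraktCol_le` — the SECOND conjunct of `FraktDoubleSum` is a theorem:
  `Σ_l l⁻²Σ_d 𝔱(dl)/d ≤ 10𝓛⁻¹⁰` (`Σ l⁻² ≤ 2`, `Σ_{l≤N} l⁻¹ ≤ 1 + log N`, `A ≥ 𝓛¹⁹`).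
* `fraktRow_sq_eq`, `fraktDoubleSum_sq_le` — the REPAIRED first conjunct: for `d > δ` at most one `l`
  has `𝔱(dl) = 1` (`eq_of_frakt_mul_eq_one`), hence `(Σ_l 𝔱(dl)/l)² = Σ_l 𝔱(dl)/l²` and
  `Σ_{d>δ} d⁻¹(Σ_l 𝔱(dl)/l)² ≤ Σ_l l⁻² Σ_d 𝔱(dl)/d` — the printed right side EXACTLY.
  `fraktDoubleSum_repaired` packages (repaired first conjunct ∧ second conjunct) in the shape of
  `FraktDoubleSum`.

On the printed first conjunct (tex L3421–L3423, WITHOUT the square): it is not what "at most one `l`"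
yields and is false for every large `D` (for `l ≤ 𝓛¹⁰/2` the `d`-window `(A/l, B/l]` lies above `δ`
and carries `Σ_d 𝔱(dl)/d ≈ 2𝓛⁻¹⁰`, so the left side is `≈ 2𝓛⁻¹⁰·log(𝓛¹⁰/2)` against a right side
`≈ (π²/6)·2𝓛⁻¹⁰`) — recorded as a GAP-LEDGER row (class printed-false-pointwise, repaired statement
= the squared form proved here, which is the shape a mean-square bound for (12.6) consumes), AND
refuted in the kernel: `fraktDoubleSum_printed_lhs_ge` (left side `≥ 24𝓛⁻¹⁰` for `𝓛 ≥ 5`),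
`fraktDoubleSum_printed_ineq_false`, `not_fraktDoubleSum : ¬ FraktDoubleSum` (at odd primes, via
the quadratic primitive character `(·/p) ⊗ ℂ` of `RootNumberTwistProofs`). Nothing here concerns Theorems 1–2 or
Landau–Siegel zeros. [cite: Zhang2022LandauSiegel, §12 p.67 (displays at tex L3418, L3421–L3423)]
-/

noncomputable section

open Real
open Literature.NumberTheory.LFunctions.Zhang2022
open Literature.NumberTheory.LFunctions.Zhang2022.Skeleton

namespace Literature.NumberTheory.LFunctions.Zhang2022.Typed.Sec12A

/-! ## The indicator `𝔱` -/

/-- `𝔱 ∈ {0, 1}`. [cite: Zhang2022LandauSiegel, §12 p.67] -/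
theorem frakt_eq_zero_or_one (D : ℕ) (y : ℝ) : frakt D y = 0 ∨ frakt D y = 1 := by
  unfold frakt
  split_ifs
  · exact Or.inr rfl
  · exact Or.inl rfl

/-- `𝔱 ≥ 0`. [cite: Zhang2022LandauSiegel, §12 p.67] -/
theorem frakt_nonneg (D : ℕ) (y : ℝ) : 0 ≤ frakt D y := by
  rcases frakt_eq_zero_or_one D y with h | h
  · rw [h]
  · rw [h]; norm_num

/-- `𝔱² = 𝔱`. [cite: Zhang2022LandauSiegel, §12 p.67] -/
theorem frakt_mul_self (D : ℕ) (y : ℝ) : frakt D y * frakt D y = frakt D y := by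
  rcases frakt_eq_zero_or_one D y with h | h <;> rw [h] <;> norm_num

/-- `𝔱(y) ≤ 𝟙{A < y ≤ B}·1` in the form used for counting: `𝔱(y) = 1 → A < y ∧ y ≤ B`.
[cite: Zhang2022LandauSiegel, §12 p.67] -/
theorem window_of_frakt_eq_one {D : ℕ} {y : ℝ} (h : frakt D y = 1) :
    bigP D ^ (0.5 : ℝ) * etaPM D (-1) < y ∧ y ≤ bigP D ^ (0.5 : ℝ) * etaPM D 1 := by
  unfold frakt at h
  split_ifs at h with hw
  · exact hw
  · norm_num at h

/-! ## The counting fact -/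

/-- **The counting fact of p. 67**: for `c ≥ 1` and any truncation `N`, with `A = P^{0.5}η₋ > 0`,
`B = P^{0.5}η₊ ≥ A`: `Σ_{1≤k≤N} 𝔱(ck)/k ≤ (B − A)/A + c/A` — the `k` with `𝔱(ck) = 1` satisfy
`A/c < k ≤ B/c` (at most `⌊B/c⌋ − ⌊A/c⌋ ≤ (B−A)/c + 1` of them) and `1/k < c/A`.
[cite: Zhang2022LandauSiegel, §12 p.67 (tex L3416–L3420)] -/
theorem sum_frakt_mul_div_le (D : ℕ) (hA : 0 < bigP D ^ (0.5 : ℝ) * etaPM D (-1))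
    (hAB : bigP D ^ (0.5 : ℝ) * etaPM D (-1) ≤ bigP D ^ (0.5 : ℝ) * etaPM D 1) {c : ℕ} (hc : 1 ≤ c)
    (N : ℕ) :
    ∑ k ∈ Finset.Icc 1 N, frakt D ((c * k : ℕ) : ℝ) / (k : ℝ) ≤
      (bigP D ^ (0.5 : ℝ) * etaPM D 1 - bigP D ^ (0.5 : ℝ) * etaPM D (-1)) /
          (bigP D ^ (0.5 : ℝ) * etaPM D (-1)) + c / (bigP D ^ (0.5 : ℝ) * etaPM D (-1)) := by
  set A : ℝ := bigP D ^ (0.5 : ℝ) * etaPM D (-1) with hAdef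
  set B : ℝ := bigP D ^ (0.5 : ℝ) * etaPM D 1 with hBdef
  have hc0 : (0 : ℝ) < c := by exact_mod_cast hc
  have hB0 : 0 ≤ B := le_trans hA.le hAB
  -- each term is at most `(c/A)·𝟙`
  have hterm : ∀ k ∈ Finset.Icc 1 N, frakt D ((c * k : ℕ) : ℝ) / (k : ℝ) ≤
      (c : ℝ) / A * (if A < ((c * k : ℕ) : ℝ) ∧ ((c * k : ℕ) : ℝ) ≤ B then 1 else 0) := by
    intro k hk
    have hk1 : (1 : ℝ) ≤ k := by exact_mod_cast (Finset.mem_Icc.mp hk).1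
    rcases frakt_eq_zero_or_one D ((c * k : ℕ) : ℝ) with h0 | h1
    · rw [h0, zero_div]
      exact mul_nonneg (div_nonneg hc0.le hA.le) (by split_ifs <;> norm_num)
    · have hw := window_of_frakt_eq_one h1
      rw [h1, if_pos hw, mul_one, div_le_div_iff₀ (by linarith) hA]
      have h1' : A < (c : ℝ) * k := by have := hw.1; push_cast at this; exact this
      linarith
  refine le_trans (Finset.sum_le_sum hterm) ?_
  rw [← Finset.mul_sum, Finset.sum_boole]
  set S := (Finset.Icc 1 N).filter (fun k : ℕ => A < ((c * k : ℕ) : ℝ) ∧ ((c * k : ℕ) : ℝ) ≤ B)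
    with hS
  have hsub : S ⊆ Finset.Ioc ⌊A / c⌋₊ ⌊B / c⌋₊ := by
    intro k hk
    rw [hS, Finset.mem_filter] at hk
    obtain ⟨-, h1, h2⟩ := hk
    push_cast at h1 h2
    rw [Finset.mem_Ioc, Nat.floor_lt (div_nonneg hA.le hc0.le), Nat.le_floor_iff (div_nonneg hB0 hc0.le),
      div_lt_iff₀ hc0, le_div_iff₀ hc0]
    constructor <;> linarith
  have hcard : (S.card : ℝ) ≤ (B - A) / c + 1 := by
    have h1 : S.card ≤ ⌊B / c⌋₊ - ⌊A / c⌋₊ := by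
      have := Finset.card_le_card hsub; rwa [Nat.card_Ioc] at this
    have hfl : ⌊A / c⌋₊ ≤ ⌊B / c⌋₊ := Nat.floor_le_floor (by gcongr)
    have h2 : (S.card : ℝ) ≤ (⌊B / c⌋₊ : ℝ) - (⌊A / c⌋₊ : ℝ) := by
      have := (Nat.cast_le (α := ℝ)).mpr h1; rwa [Nat.cast_sub hfl] at this
    have hBf : (⌊B / c⌋₊ : ℝ) ≤ B / c := Nat.floor_le (div_nonneg hB0 hc0.le)
    have hAf : A / c < (⌊A / c⌋₊ : ℝ) + 1 := Nat.lt_floor_add_one _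
    have : (B - A) / c = B / c - A / c := by ring
    linarith
  calc (c : ℝ) / A * (S.card : ℝ) ≤ (c : ℝ) / A * ((B - A) / c + 1) :=
        mul_le_mul_of_nonneg_left hcard (div_nonneg hc0.le hA.le)
    _ = (B - A) / A + c / A := by field_simp

/-! ## "D sufficiently large" for this page -/

/-- For `D ≥ ⌈e^M⌉`, `𝓛 = log D ≥ M`. [cite: Zhang2022LandauSiegel, §2 p.4] -/
private theorem le_ell_of_ceil_exp_le {M : ℝ} {D : ℕ} (hD : ⌈Real.exp M⌉₊ ≤ D) : M ≤ ell D := by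
  have h : Real.exp M ≤ D := le_trans (Nat.le_ceil _) (by exact_mod_cast hD)
  exact (Real.le_log_iff_exp_le (lt_of_lt_of_le (Real.exp_pos _) h)).mpr h

/-- The window parameters for `𝓛 ≥ 2`: `A = P^{0.5}η₋ > 0`, `A ≤ B`, `(B − A)/A = e^{2𝓛⁻¹⁰} − 1 ≤ 4𝓛⁻¹⁰`,
`A ≥ 𝓛¹⁹`, `log B ≤ 𝓛⁹ − 1`. [cite: Zhang2022LandauSiegel, §11 p.62 (`η_±`), §12 p.67] -/
theorem window_params {D : ℕ} (hL : 2 ≤ ell D) :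
    0 < bigP D ^ (0.5 : ℝ) * etaPM D (-1) ∧
      bigP D ^ (0.5 : ℝ) * etaPM D (-1) ≤ bigP D ^ (0.5 : ℝ) * etaPM D 1 ∧
      (bigP D ^ (0.5 : ℝ) * etaPM D 1 - bigP D ^ (0.5 : ℝ) * etaPM D (-1)) /
          (bigP D ^ (0.5 : ℝ) * etaPM D (-1)) ≤ 4 * (ell D ^ 10)⁻¹ ∧
      ell D ^ 19 ≤ bigP D ^ (0.5 : ℝ) * etaPM D (-1) ∧
      Real.log (bigP D ^ (0.5 : ℝ) * etaPM D 1) ≤ ell D ^ 9 - 1 := by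
  have hℓ0 : 0 < ell D := by linarith
  have hℓ1 : 1 ≤ ell D := by linarith
  have h10 : (1024 : ℝ) ≤ ell D ^ 10 := by
    calc (1024 : ℝ) = 2 ^ 10 := by norm_num
      _ ≤ ell D ^ 10 := pow_le_pow_left₀ (by norm_num) hL 10
  have hQ : bigP D ^ (0.5 : ℝ) = Real.exp (ell D ^ 9 * 0.5) := by rw [bigP, Real.exp_mul]
  have hQpos : 0 < bigP D ^ (0.5 : ℝ) := by rw [hQ]; exact Real.exp_pos _
  have hηm : 0 < etaPM D (-1) := Real.exp_pos _
  have hηp : 0 < etaPM D 1 := Real.exp_pos _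
  set x : ℝ := (ell D ^ 10)⁻¹ with hx
  have hx0 : 0 < x := by rw [hx]; positivity
  have hx1 : x ≤ 1 / 1024 := by
    rw [hx]; exact inv_le_of_inv_le₀ (by norm_num) (by rw [inv_div]; simpa using h10)
  have hηm_eq : etaPM D (-1) = Real.exp (-x) := by rw [etaPM, hx]; ring_nf
  have hηp_eq : etaPM D 1 = Real.exp x := by rw [etaPM, hx]; ring_nf
  have hA0 : 0 < bigP D ^ (0.5 : ℝ) * etaPM D (-1) := mul_pos hQpos hηm
  have hAB : bigP D ^ (0.5 : ℝ) * etaPM D (-1) ≤ bigP D ^ (0.5 : ℝ) * etaPM D 1 := by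
    rw [hηm_eq, hηp_eq]; gcongr; linarith
  refine ⟨hA0, hAB, ?_, ?_, ?_⟩
  · -- (B − A)/A = e^{2x} − 1 ≤ 4x
    have hratio : (bigP D ^ (0.5 : ℝ) * etaPM D 1 - bigP D ^ (0.5 : ℝ) * etaPM D (-1)) /
        (bigP D ^ (0.5 : ℝ) * etaPM D (-1)) = Real.exp (2 * x) - 1 := by
      rw [hηm_eq, hηp_eq, ← mul_sub, mul_div_mul_left _ _ hQpos.ne', sub_div, div_self
        (Real.exp_pos _).ne', ← Real.exp_sub]
      ring_nf
    rw [hratio]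
    have h2x : |2 * x| ≤ 1 := by rw [abs_of_pos (by linarith)]; linarith
    have := Real.abs_exp_sub_one_le h2x
    rw [abs_of_pos (by linarith : 0 < 2 * x)] at this
    linarith [le_abs_self (Real.exp (2 * x) - 1)]
  · -- A ≥ 𝓛¹⁹: A ≥ Q/2 and Q = e^{𝓛⁹/2} ≥ (𝓛⁹/2)³/6
    have hηhalf : (1 : ℝ) / 2 ≤ etaPM D (-1) := by
      rw [hηm_eq]
      have := Real.add_one_le_exp (-x)
      linarith
    have hQlow : (ell D ^ 9 * 0.5) ^ 3 / 6 ≤ bigP D ^ (0.5 : ℝ) := by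
      rw [hQ]
      have := Real.pow_div_factorial_le_exp (x := ell D ^ 9 * 0.5) (by positivity) 3
      simpa [Nat.factorial] using this
    have h8 : (256 : ℝ) ≤ ell D ^ 8 := by
      calc (256 : ℝ) = 2 ^ 8 := by norm_num
        _ ≤ ell D ^ 8 := pow_le_pow_left₀ (by norm_num) hL 8
    calc ell D ^ 19 ≤ (ell D ^ 9 * 0.5) ^ 3 / 6 * (1 / 2) := by
          have : (ell D ^ 9 * 0.5) ^ 3 / 6 * (1 / 2) = ell D ^ 19 * (ell D ^ 8 / 96) := by ring
          rw [this]
          have hℓ19 : 0 ≤ ell D ^ 19 := by positivity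
          nlinarith
      _ ≤ bigP D ^ (0.5 : ℝ) * etaPM D (-1) := by gcongr
  · -- log B = 𝓛⁹/2 + x ≤ 𝓛⁹ − 1
    rw [Real.log_mul hQpos.ne' hηp.ne', hQ, Real.log_exp, hηp_eq, Real.log_exp]
    have h9 : (512 : ℝ) ≤ ell D ^ 9 := by
      calc (512 : ℝ) = 2 ^ 9 := by norm_num
        _ ≤ ell D ^ 9 := pow_le_pow_left₀ (by norm_num) hL 9
    linarith

/-! ## `Z22:§12.u007`: the row sums for small `d` -/

/-- **`Z22:§12.u007` is a theorem**: "If `d ≤ P^{0.5}(η₊ − η₋)`, then `Σ_l 𝔱(dl)/l ≪ 𝓛⁻¹⁰`" — with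
`C = 8`, for every `D` with `𝓛 ≥ 2` (no (A) needed): `Σ_l 𝔱(dl)/l ≤ (B−A)/A + d/A ≤ 2(B−A)/A =
2(e^{2𝓛⁻¹⁰} − 1) ≤ 8𝓛⁻¹⁰`. [cite: Zhang2022LandauSiegel, §12 p.67, tex L3416–L3418] -/
theorem fraktRowSmall_holds : FraktRowSmall := by
  refine ⟨8, ⌈Real.exp 2⌉₊, fun D _ _ hD _ _ d hd hdδ => ?_⟩
  have hL : 2 ≤ ell D := le_ell_of_ceil_exp_le hD
  obtain ⟨hA0, hAB, hratio, -, -⟩ := window_params hL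
  have h := sum_frakt_mul_div_le D hA0 hAB hd (fraktN D)
  rw [fraktRow]
  refine le_trans h ?_
  have hd' : (d : ℝ) / (bigP D ^ (0.5 : ℝ) * etaPM D (-1)) ≤
      (bigP D ^ (0.5 : ℝ) * etaPM D 1 - bigP D ^ (0.5 : ℝ) * etaPM D (-1)) /
        (bigP D ^ (0.5 : ℝ) * etaPM D (-1)) := by
    rw [← mul_sub] at *
    exact div_le_div_of_nonneg_right hdδ hA0.le
  linarith

/-! ## `Z22:§12.u008`, second conjunct: `Σ_l l⁻² Σ_d 𝔱(dl)/d ≪ 𝓛⁻¹⁰` -/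

/-- The column sums: `Σ_d 𝔱(dl)/d ≤ (B−A)/A + l/A` for `l ≥ 1` (the counting fact with the roles of
`d` and `l` exchanged). [cite: Zhang2022LandauSiegel, §12 p.67] -/
theorem fraktCol_le {D : ℕ} (hA : 0 < bigP D ^ (0.5 : ℝ) * etaPM D (-1))
    (hAB : bigP D ^ (0.5 : ℝ) * etaPM D (-1) ≤ bigP D ^ (0.5 : ℝ) * etaPM D 1) {l : ℕ} (hl : 1 ≤ l) :
    fraktCol D l ≤ (bigP D ^ (0.5 : ℝ) * etaPM D 1 - bigP D ^ (0.5 : ℝ) * etaPM D (-1)) /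
        (bigP D ^ (0.5 : ℝ) * etaPM D (-1)) + l / (bigP D ^ (0.5 : ℝ) * etaPM D (-1)) := by
  have h := sum_frakt_mul_div_le D hA hAB hl (fraktN D)
  rw [fraktCol]
  refine le_trans (le_of_eq (Finset.sum_congr rfl fun d _ => by rw [Nat.mul_comm])) h

/-- `Σ_{1≤l≤N} l⁻² ≤ 2`. [folklore] -/
private theorem sum_Icc_inv_sq_le_two (N : ℕ) : ∑ l ∈ Finset.Icc 1 N, ((l : ℝ) ^ 2)⁻¹ ≤ 2 := by
  have h := sum_Ioo_inv_sq_le (α := ℝ) 0 (N + 1)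
  have hI : Finset.Ioo 0 (N + 1) = Finset.Icc 1 N := by
    ext l; simp only [Finset.mem_Ioo, Finset.mem_Icc]; omega
  rw [hI] at h
  simpa using h

/-- `Σ_{1≤l≤N} l⁻¹ ≤ 1 + log N` (Mathlib's `harmonic_le_one_add_log`). [folklore] -/
private theorem sum_Icc_inv_le_one_add_log (N : ℕ) :
    ∑ l ∈ Finset.Icc 1 N, (l : ℝ)⁻¹ ≤ 1 + Real.log N := by
  have h := harmonic_le_one_add_log N
  rw [harmonic_eq_sum_Icc, Rat.cast_sum] at h
  simpa using h

/-- **`Z22:§12.u008`, second conjunct, is a theorem**: `Σ_l l⁻²Σ_d 𝔱(dl)/d ≤ 10𝓛⁻¹⁰` for `𝓛 ≥ 2`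
(`≤ (B−A)/A·Σl⁻² + A⁻¹Σ_{l≤N} l⁻¹ ≤ 8𝓛⁻¹⁰ + (1 + log B)/A`, `A ≥ 𝓛¹⁹`, `log B ≤ 𝓛⁹ − 1`).
[cite: Zhang2022LandauSiegel, §12 p.67, tex L3421–L3423] -/
theorem sum_inv_sq_mul_fraktCol_le {D : ℕ} (hL : 2 ≤ ell D) :
    ∑ l ∈ Finset.Icc 1 (fraktN D), ((l : ℝ) ^ 2)⁻¹ * fraktCol D l ≤ 10 * (ell D ^ 10)⁻¹ := by
  obtain ⟨hA0, hAB, hratio, hA19, hlogB⟩ := window_params hL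
  set A : ℝ := bigP D ^ (0.5 : ℝ) * etaPM D (-1) with hAdef
  set B : ℝ := bigP D ^ (0.5 : ℝ) * etaPM D 1 with hBdef
  set N : ℕ := fraktN D with hNdef
  have hℓ0 : 0 < ell D := by linarith
  have hℓ10 : 0 < ell D ^ 10 := pow_pos hℓ0 10
  -- termwise
  have hterm : ∀ l ∈ Finset.Icc 1 N, ((l : ℝ) ^ 2)⁻¹ * fraktCol D l ≤
      (B - A) / A * ((l : ℝ) ^ 2)⁻¹ + A⁻¹ * (l : ℝ)⁻¹ := by
    intro l hl
    have hl1 : 1 ≤ l := (Finset.mem_Icc.mp hl).1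
    have hl1' : (1 : ℝ) ≤ l := by exact_mod_cast hl1
    have h := fraktCol_le hA0 hAB hl1
    calc ((l : ℝ) ^ 2)⁻¹ * fraktCol D l ≤ ((l : ℝ) ^ 2)⁻¹ * ((B - A) / A + l / A) :=
          mul_le_mul_of_nonneg_left h (by positivity)
      _ = (B - A) / A * ((l : ℝ) ^ 2)⁻¹ + A⁻¹ * (l : ℝ)⁻¹ := by
          field_simp
  refine le_trans (Finset.sum_le_sum hterm) ?_
  rw [Finset.sum_add_distrib, ← Finset.mul_sum, ← Finset.mul_sum]
  have h1 : (B - A) / A * ∑ l ∈ Finset.Icc 1 N, ((l : ℝ) ^ 2)⁻¹ ≤ 4 * (ell D ^ 10)⁻¹ * 2 :=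
    mul_le_mul hratio (sum_Icc_inv_sq_le_two N) (Finset.sum_nonneg fun l _ => by positivity)
      (by positivity)
  -- the harmonic part: `A⁻¹(1 + log N) ≤ 𝓛⁹/𝓛¹⁹ = 𝓛⁻¹⁰`
  have hN : (N : ℝ) ≤ B := Nat.floor_le (le_trans hA0.le hAB)
  have hlogN : Real.log N ≤ ell D ^ 9 - 1 := by
    rcases Nat.eq_zero_or_pos N with h0 | hpos
    · rw [h0, Nat.cast_zero, Real.log_zero]
      have : (1 : ℝ) ≤ ell D ^ 9 := one_le_pow₀ (by linarith)
      linarith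
    · exact le_trans (Real.log_le_log (by exact_mod_cast hpos) hN) hlogB
  have h2 : A⁻¹ * ∑ l ∈ Finset.Icc 1 N, (l : ℝ)⁻¹ ≤ (ell D ^ 10)⁻¹ := by
    calc A⁻¹ * ∑ l ∈ Finset.Icc 1 N, (l : ℝ)⁻¹ ≤ A⁻¹ * (1 + Real.log N) :=
          mul_le_mul_of_nonneg_left (sum_Icc_inv_le_one_add_log N) (inv_nonneg.mpr hA0.le)
      _ ≤ (ell D ^ 19)⁻¹ * ell D ^ 9 :=
          mul_le_mul (inv_anti₀ (pow_pos hℓ0 19) hA19) (by linarith)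
            (by linarith [Real.log_natCast_nonneg N]) (inv_nonneg.mpr (pow_nonneg hℓ0.le 19))
      _ = (ell D ^ 10)⁻¹ := by field_simp
  have hℓinv : 0 ≤ (ell D ^ 10)⁻¹ := inv_nonneg.mpr hℓ10.le
  linarith

/-! ## `Z22:§12.u008`, first conjunct, REPAIRED: the square that "at most one `l`" produces -/

/-- For `d > P^{0.5}(η₊ − η₋)`, "there exists at most one `l` such that `𝔱(dl) = 1`"
(`eq_of_frakt_mul_eq_one`), HENCE `(Σ_l 𝔱(dl)/l)² = Σ_l 𝔱(dl)/l²`.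
[cite: Zhang2022LandauSiegel, §12 p.67, tex L3420–L3421] -/
theorem fraktRow_sq_eq {D d : ℕ} (hd : bigP D ^ (0.5 : ℝ) * (etaPM D 1 - etaPM D (-1)) < d) :
    fraktRow D d ^ 2 = ∑ l ∈ Finset.Icc 1 (fraktN D), frakt D ((d * l : ℕ) : ℝ) / (l : ℝ) ^ 2 := by
  rw [fraktRow, sq, Finset.sum_mul_sum]
  refine Finset.sum_congr rfl fun l₁ h₁ => ?_
  rw [Finset.sum_eq_single_of_mem l₁ h₁]
  · rw [div_mul_div_comm, frakt_mul_self, sq]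
  · intro l₂ _ hne
    rcases frakt_eq_zero_or_one D ((d * l₁ : ℕ) : ℝ) with h0 | h1
    · rw [h0]; simp
    rcases frakt_eq_zero_or_one D ((d * l₂ : ℕ) : ℝ) with h0' | h1'
    · rw [h0']; simp
    exact absurd (eq_of_frakt_mul_eq_one hd h1' h1) hne

/-- **`Z22:§12.u008`, first conjunct, repaired** (the inner sum SQUARED, as "at most one `l`" gives):
`Σ_{d>P^{0.5}(η₊−η₋)} d⁻¹(Σ_l 𝔱(dl)/l)² ≤ Σ_l l⁻² Σ_d 𝔱(dl)/d`, for EVERY `D` (pure counting;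
sums truncated at `fraktN` as typed). [cite: Zhang2022LandauSiegel, §12 p.67, tex L3421–L3423] -/
theorem fraktDoubleSum_sq_le (D : ℕ) :
    ∑ d ∈ (Finset.Icc 1 (fraktN D)).filter
        (fun d : ℕ => bigP D ^ (0.5 : ℝ) * (etaPM D 1 - etaPM D (-1)) < d),
      (d : ℝ)⁻¹ * fraktRow D d ^ 2 ≤
    ∑ l ∈ Finset.Icc 1 (fraktN D), ((l : ℝ) ^ 2)⁻¹ * fraktCol D l := by
  have hrw : ∀ d ∈ (Finset.Icc 1 (fraktN D)).filter
      (fun d : ℕ => bigP D ^ (0.5 : ℝ) * (etaPM D 1 - etaPM D (-1)) < d),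
      (d : ℝ)⁻¹ * fraktRow D d ^ 2 =
        ∑ l ∈ Finset.Icc 1 (fraktN D), (d : ℝ)⁻¹ * (frakt D ((d * l : ℕ) : ℝ) / (l : ℝ) ^ 2) := by
    intro d hd
    rw [fraktRow_sq_eq (Finset.mem_filter.mp hd).2, Finset.mul_sum]
  rw [Finset.sum_congr rfl hrw]
  have hnn : ∀ d ∈ Finset.Icc 1 (fraktN D),
      0 ≤ ∑ l ∈ Finset.Icc 1 (fraktN D), (d : ℝ)⁻¹ * (frakt D ((d * l : ℕ) : ℝ) / (l : ℝ) ^ 2) :=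
    fun d _ => Finset.sum_nonneg fun l _ =>
      mul_nonneg (inv_nonneg.mpr (Nat.cast_nonneg d)) (div_nonneg (frakt_nonneg _ _) (sq_nonneg _))
  refine le_trans (Finset.sum_le_sum_of_subset_of_nonneg (Finset.filter_subset _ _)
    fun d hd _ => hnn d hd) ?_
  rw [Finset.sum_comm]
  refine le_of_eq (Finset.sum_congr rfl fun l _ => ?_)
  rw [fraktCol, Finset.mul_sum]
  refine Finset.sum_congr rfl fun d _ => ?_
  ring

/-- **`FraktDoubleSum`, repaired** — the typed node with the first conjunct's inner sum squared (the
form "at most one `l`" yields and a mean-square argument for (12.6) consumes), `C = 10`: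
`(Σ_{d>δ} d⁻¹(Σ_l 𝔱(dl)/l)² ≤ Σ_l l⁻²Σ_d 𝔱(dl)/d) ∧ (Σ_l l⁻²Σ_d 𝔱(dl)/d ≤ 10𝓛⁻¹⁰)` for `𝓛 ≥ 2`.
The AS-PRINTED first conjunct (no square) is NOT asserted here (see the module docstring and the
GAP-LEDGER row). [cite: Zhang2022LandauSiegel, §12 p.67, tex L3421–L3423] -/
theorem fraktDoubleSum_repaired :
    ∃ C : ℝ, ForAllLarge fun D _ _ =>
      (∑ d ∈ (Finset.Icc 1 (fraktN D)).filter
            (fun d : ℕ => bigP D ^ (0.5 : ℝ) * (etaPM D 1 - etaPM D (-1)) < d),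
          (d : ℝ)⁻¹ * fraktRow D d ^ 2 ≤
        ∑ l ∈ Finset.Icc 1 (fraktN D), ((l : ℝ) ^ 2)⁻¹ * fraktCol D l) ∧
      (∑ l ∈ Finset.Icc 1 (fraktN D), ((l : ℝ) ^ 2)⁻¹ * fraktCol D l ≤ C * (ell D ^ 10)⁻¹) :=
  ⟨10, ⌈Real.exp 2⌉₊, fun D _ _ hD _ _ =>
    ⟨fraktDoubleSum_sq_le D, sum_inv_sq_mul_fraktCol_le (le_ell_of_ceil_exp_le hD)⟩⟩

/-- The second conjunct of the typed `FraktDoubleSum` on its own, in `ForAllLarge` form (`C = 10`).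
[cite: Zhang2022LandauSiegel, §12 p.67, tex L3422–L3423] -/
theorem fraktDoubleSum_right :
    ∃ C : ℝ, ForAllLarge fun D _ _ =>
      ∑ l ∈ Finset.Icc 1 (fraktN D), ((l : ℝ) ^ 2)⁻¹ * fraktCol D l ≤ C * (ell D ^ 10)⁻¹ :=
  ⟨10, ⌈Real.exp 2⌉₊, fun _ _ _ hD _ _ => sum_inv_sq_mul_fraktCol_le (le_ell_of_ceil_exp_le hD)⟩

/-! ## The printed first conjunct of `Z22:§12.u008` fails for every large `D` (kernel certificate) -/

/-- Harmonic lower bound: `log(M+1) − 1 ≤ Σ_{2≤l≤M} l⁻¹`. [folklore] -/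
private theorem log_sub_one_le_sum_Icc_two {M : ℕ} (hM : 1 ≤ M) :
    Real.log ((M : ℝ) + 1) - 1 ≤ ∑ l ∈ Finset.Icc 2 M, (l : ℝ)⁻¹ := by
  have h := log_add_one_le_harmonic M
  rw [harmonic_eq_sum_Icc, Rat.cast_sum] at h
  have h' : Real.log ((M : ℝ) + 1) ≤ ∑ l ∈ Finset.Icc 1 M, (l : ℝ)⁻¹ := by
    push_cast at h ⊢; simpa using h
  have hsplit : ∑ l ∈ Finset.Icc 1 M, (l : ℝ)⁻¹ = 1 + ∑ l ∈ Finset.Icc 2 M, (l : ℝ)⁻¹ := by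
    have hI : Finset.Icc 1 M = insert 1 (Finset.Icc 2 M) := by
      ext l; simp only [Finset.mem_insert, Finset.mem_Icc]; omega
    rw [hI, Finset.sum_insert (by simp)]
    norm_num
  linarith

set_option maxHeartbeats 400000 in
/-- **The printed first display of `Z22:§12.u008` has a LARGE left side**: for `𝓛 = log D ≥ 5`,
`Σ_{d>P^{0.5}(η₊−η₋)} d⁻¹(Σ_l 𝔱(dl)/l) ≥ 24𝓛⁻¹⁰`. Proof: for `2 ≤ l ≤ 2²⁰` the `d`-windows
`W_l = (A/l, B/l] ∩ ℕ` are pairwise disjoint, lie above `δ = B − A` (as `4·2²⁰·𝓛⁻¹⁰ < 1`), and each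
`d ∈ W_l` has `𝔱(dl) = 1`, so it contributes `≥ d⁻¹l⁻¹ ≥ B⁻¹`; `#W_l ≥ (B−A)/l − 1`, whence the left
side is `≥ ((B−A)/B)(H_{2²⁰} − 1) − 2²⁰/B ≥ 1.99𝓛⁻¹⁰·(20 log 2 − 1) − 0.54𝓛⁻¹⁰ ≥ 24𝓛⁻¹⁰`.
[cite: Zhang2022LandauSiegel, §12 p.67, tex L3421–L3423] -/
theorem fraktDoubleSum_printed_lhs_ge {D : ℕ} (hL : 5 ≤ ell D) :
    24 * (ell D ^ 10)⁻¹ ≤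
      ∑ d ∈ (Finset.Icc 1 (fraktN D)).filter
          (fun d : ℕ => bigP D ^ (0.5 : ℝ) * (etaPM D 1 - etaPM D (-1)) < d),
        (d : ℝ)⁻¹ * fraktRow D d := by
  have hL2 : 2 ≤ ell D := by linarith
  obtain ⟨hA0, hAB, -, hA19, -⟩ := window_params hL2
  have hℓ0 : 0 < ell D := by linarith
  -- abbreviations
  set Q : ℝ := bigP D ^ (0.5 : ℝ) with hQdef
  set A : ℝ := Q * etaPM D (-1) with hAdef
  set B : ℝ := Q * etaPM D 1 with hBdef
  set N : ℕ := fraktN D with hNdef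
  set x : ℝ := (ell D ^ 10)⁻¹ with hxdef
  set M : ℕ := 2 ^ 20 with hMdef
  have hB0 : 0 < B := lt_of_lt_of_le hA0 hAB
  have hQpos : 0 < Q := by rw [hQdef]; exact Real.rpow_pos_of_pos (Real.exp_pos _) _
  -- numerics in `x`
  have h10 : (9765625 : ℝ) ≤ ell D ^ 10 := by
    calc (9765625 : ℝ) = 5 ^ 10 := by norm_num
      _ ≤ ell D ^ 10 := pow_le_pow_left₀ (by norm_num) hL 10
  have hx0 : 0 < x := by rw [hxdef]; positivity
  have hx1 : x ≤ 1 / 9765625 := by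
    rw [hxdef]; exact inv_le_of_inv_le₀ (by norm_num) (by rw [inv_div]; simpa using h10)
  have hMx : 4 * (M : ℝ) * x < 1 := by
    rw [hMdef]; push_cast; nlinarith
  -- `η₋ = e^{−x}`, `η₊ = e^{x}`; `B/A = e^{2x} ≤ 1 + 4x`; `(B − A)/B ≥ 1.99x`
  have hηm_eq : etaPM D (-1) = Real.exp (-x) := by rw [etaPM, hxdef]; ring_nf
  have hηp_eq : etaPM D 1 = Real.exp x := by rw [etaPM, hxdef]; ring_nf
  have hBA : B = A * Real.exp (2 * x) := by
    rw [hAdef, hBdef, hηm_eq, hηp_eq, mul_assoc, ← Real.exp_add]; ring_nf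
  have hexp2x : Real.exp (2 * x) ≤ 1 + 4 * x := by
    have h2x : |2 * x| ≤ 1 := by rw [abs_of_pos (by linarith)]; linarith
    have := Real.abs_exp_sub_one_le h2x
    rw [abs_of_pos (by linarith : 0 < 2 * x)] at this
    linarith [le_abs_self (Real.exp (2 * x) - 1)]
  have hBle : B ≤ A * (1 + 4 * x) := by rw [hBA]; exact mul_le_mul_of_nonneg_left hexp2x hA0.le
  have hfrac : (199 / 100) * x ≤ (B - A) / B := by
    -- `(B−A)/B = 1 − e^{−2x} ≥ 1 − 1/(1+2x) = 2x/(1+2x)`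
    have hAB' : A / B = Real.exp (-(2 * x)) := by
      rw [hBA, Real.exp_neg]; field_simp
    have h1 : (B - A) / B = 1 - Real.exp (-(2 * x)) := by
      rw [sub_div, div_self hB0.ne', hAB']
    have h2 : Real.exp (-(2 * x)) ≤ (1 + 2 * x)⁻¹ := by
      rw [Real.exp_neg]
      exact inv_anti₀ (by linarith) (by linarith [Real.add_one_le_exp (2 * x)])
    have h3 : (199 / 100) * x ≤ 1 - (1 + 2 * x)⁻¹ := by
      rw [show 1 - (1 + 2 * x)⁻¹ = 2 * x / (1 + 2 * x) by field_simp; ring]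
      rw [le_div_iff₀ (by linarith)]
      nlinarith
    linarith
  -- `δ = B − A < A/M` and the window facts
  have hδ : B - A ≤ A * (4 * x) := by linarith
  have hδM : (M : ℝ) * (B - A) < A := by
    have : (M : ℝ) * (A * (4 * x)) = A * (4 * (M : ℝ) * x) := by ring
    nlinarith
  have hM1 : (1 : ℝ) ≤ M := by rw [hMdef]; norm_num
  have hMN : M ≤ N := by
    -- `M ≤ 𝓛¹⁹ ≤ A ≤ B`, so `M ≤ ⌊B⌋`
    have h19 : (M : ℝ) ≤ ell D ^ 19 := by
      calc (M : ℝ) = 2 ^ 20 := by rw [hMdef]; norm_num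
        _ ≤ 5 ^ 19 := by norm_num
        _ ≤ ell D ^ 19 := pow_le_pow_left₀ (by norm_num) hL 19
    have hNB : N = ⌊B⌋₊ := by rw [hNdef, hBdef, hQdef]; rfl
    rw [hNB]
    exact Nat.le_floor (by linarith)
  -- the windows
  let W : ℕ → Finset ℕ := fun l => Finset.Ioc ⌊A / l⌋₊ ⌊B / l⌋₊
  have hWmem : ∀ l ∈ Finset.Icc 2 M, ∀ d ∈ W l,
      (0 : ℝ) < d ∧ A < (d : ℝ) * l ∧ (d : ℝ) * l ≤ B ∧ (0 : ℝ) < l := by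
    intro l hl d hd
    obtain ⟨hl2, hlM⟩ := Finset.mem_Icc.mp hl
    have hl0 : (0 : ℝ) < l := by exact_mod_cast (show 0 < l by omega)
    obtain ⟨hd1, hd2⟩ := Finset.mem_Ioc.mp hd
    have hA' : A / l < d := by
      have := Nat.lt_floor_add_one (A / l)
      have h' : (⌊A / l⌋₊ : ℝ) + 1 ≤ d := by exact_mod_cast hd1
      linarith
    have hB' : (d : ℝ) ≤ B / l := le_trans (by exact_mod_cast hd2) (Nat.floor_le (by positivity))
    refine ⟨lt_of_le_of_lt (by positivity) hA', ?_, ?_, hl0⟩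
    · rwa [div_lt_iff₀ hl0] at hA'
    · rwa [le_div_iff₀ hl0] at hB'
  have hWsub : ∀ l ∈ Finset.Icc 2 M, W l ⊆ (Finset.Icc 1 N).filter
      (fun d : ℕ => bigP D ^ (0.5 : ℝ) * (etaPM D 1 - etaPM D (-1)) < d) := by
    intro l hl d hd
    obtain ⟨hl2, hlM⟩ := Finset.mem_Icc.mp hl
    obtain ⟨hd0, hA', hB', hl0⟩ := hWmem l hl d hd
    have hlM' : (l : ℝ) ≤ M := by exact_mod_cast hlM
    have hl1 : (1 : ℝ) ≤ l := by exact_mod_cast (show 1 ≤ l by omega)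
    rw [Finset.mem_filter, Finset.mem_Icc]
    refine ⟨⟨by exact_mod_cast hd0, ?_⟩, ?_⟩
    · -- `d ≤ B/l ≤ B`, so `d ≤ ⌊B⌋ = N`
      have hNB : N = ⌊B⌋₊ := by rw [hNdef, hBdef, hQdef]; rfl
      rw [hNB]
      apply Nat.le_floor
      have : (d : ℝ) ≤ (d : ℝ) * l := le_mul_of_one_le_right hd0.le hl1
      exact le_trans this hB'
    · -- `δ = B − A < A/M ≤ A/l < d`
      have hδ' : bigP D ^ (0.5 : ℝ) * (etaPM D 1 - etaPM D (-1)) = B - A := by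
        rw [hAdef, hBdef, hQdef]; ring
      rw [hδ']
      -- from `M(B−A) < A < d l ≤ d M`
      have h1 : (d : ℝ) * l ≤ d * M := mul_le_mul_of_nonneg_left hlM' hd0.le
      have h2 : (B - A) * M < d * M := by linarith
      exact lt_of_mul_lt_mul_right h2 (by positivity)
  have hWdisj : (↑(Finset.Icc 2 M) : Set ℕ).PairwiseDisjoint W := by
    intro l hl l' hl' hne
    rw [Function.onFun, Finset.disjoint_left]
    intro d hd hd'
    obtain ⟨hd0, hA1, hB1, hl0⟩ := hWmem l hl d hd
    obtain ⟨-, hA2, hB2, hl0'⟩ := hWmem l' hl' d hd'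
    have hlM : (l : ℝ) ≤ M := by exact_mod_cast (Finset.mem_Icc.mp hl).2
    have hlM' : (l' : ℝ) ≤ M := by exact_mod_cast (Finset.mem_Icc.mp hl').2
    -- `A·max(l,l') < d·l·l' ≤ B·min(l,l')`, `|l − l'| ≥ 1`, contradicting `B ≤ A(1+4x)`, `4Mx < 1`
    have hxA : A * (4 * (M : ℝ) * x) < A * 1 := mul_lt_mul_of_pos_left hMx hA0
    rcases lt_or_gt_of_ne hne with h | h
    · have h1 : (l : ℝ) + 1 ≤ l' := by exact_mod_cast h
      -- `A l' < d l l' ≤ B l ≤ A(1+4x) l`, `l' ≥ l + 1` ⇒ `1 < 4xl ≤ 4xM`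
      have e1 : A * l' < B * l :=
        calc A * l' < (d : ℝ) * l * l' := mul_lt_mul_of_pos_right hA1 hl0'
          _ = (d : ℝ) * l' * l := by ring
          _ ≤ B * l := mul_le_mul_of_nonneg_right hB2 hl0.le
      have e2 : B * l ≤ A * (1 + 4 * x) * l := mul_le_mul_of_nonneg_right hBle hl0.le
      have e3 : A * ((l : ℝ) + 1) ≤ A * l' := mul_le_mul_of_nonneg_left h1 hA0.le
      have e4 : A * x * l ≤ A * x * M := mul_le_mul_of_nonneg_left hlM (mul_nonneg hA0.le hx0.le)
      linarith
    · have h1 : (l' : ℝ) + 1 ≤ l := by exact_mod_cast h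
      have e1 : A * l < B * l' :=
        calc A * l < (d : ℝ) * l' * l := mul_lt_mul_of_pos_right hA2 hl0
          _ = (d : ℝ) * l * l' := by ring
          _ ≤ B * l' := mul_le_mul_of_nonneg_right hB1 hl0'.le
      have e2 : B * l' ≤ A * (1 + 4 * x) * l' := mul_le_mul_of_nonneg_right hBle hl0'.le
      have e3 : A * ((l' : ℝ) + 1) ≤ A * l := mul_le_mul_of_nonneg_left h1 hA0.le
      have e4 : A * x * l' ≤ A * x * M := mul_le_mul_of_nonneg_left hlM' (mul_nonneg hA0.le hx0.le)
      linarith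
  -- each `d ∈ W_l` contributes at least `B⁻¹`
  have hterm : ∀ l ∈ Finset.Icc 2 M, ∀ d ∈ W l, B⁻¹ ≤ (d : ℝ)⁻¹ * fraktRow D d := by
    intro l hl d hd
    obtain ⟨hl2, hlM⟩ := Finset.mem_Icc.mp hl
    obtain ⟨hd0, hA', hB', hl0⟩ := hWmem l hl d hd
    have hlN : l ∈ Finset.Icc 1 N := Finset.mem_Icc.mpr ⟨by omega, le_trans hlM hMN⟩
    have ht1 : frakt D ((d * l : ℕ) : ℝ) = 1 := by
      unfold frakt
      rw [if_pos]
      push_cast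
      exact ⟨hA', hB'⟩
    have hrow : (l : ℝ)⁻¹ ≤ fraktRow D d := by
      rw [fraktRow]
      have h := Finset.single_le_sum (f := fun l' : ℕ => frakt D ((d * l' : ℕ) : ℝ) / (l' : ℝ))
        (fun l' _ => div_nonneg (frakt_nonneg _ _) (Nat.cast_nonneg l')) hlN
      simp only [ht1, one_div] at h
      exact h
    calc B⁻¹ ≤ ((d : ℝ) * l)⁻¹ := inv_anti₀ (by positivity) hB'
      _ = (d : ℝ)⁻¹ * (l : ℝ)⁻¹ := by rw [mul_inv]
      _ ≤ (d : ℝ)⁻¹ * fraktRow D d := mul_le_mul_of_nonneg_left hrow (by positivity)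
  -- the cardinality of a window
  have hcard : ∀ l ∈ Finset.Icc 2 M, (B - A) / l - 1 ≤ ((W l).card : ℝ) := by
    intro l hl
    have hl0 : (0 : ℝ) < l := by exact_mod_cast (show 0 < l by have := (Finset.mem_Icc.mp hl).1; omega)
    have hfl : ⌊A / l⌋₊ ≤ ⌊B / l⌋₊ := Nat.floor_le_floor (by gcongr)
    have hc : ((W l).card : ℝ) = (⌊B / l⌋₊ : ℝ) - (⌊A / l⌋₊ : ℝ) := by
      show ((Finset.Ioc ⌊A / l⌋₊ ⌊B / l⌋₊).card : ℝ) = _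
      rw [Nat.card_Ioc, Nat.cast_sub hfl]
    have hBf : B / l < (⌊B / l⌋₊ : ℝ) + 1 := Nat.lt_floor_add_one _
    have hAf : (⌊A / l⌋₊ : ℝ) ≤ A / l := Nat.floor_le (by positivity)
    have : (B - A) / l = B / l - A / l := by ring
    linarith
  -- assemble
  have hnn : ∀ d ∈ (Finset.Icc 1 N).filter
      (fun d : ℕ => bigP D ^ (0.5 : ℝ) * (etaPM D 1 - etaPM D (-1)) < d),
      0 ≤ (d : ℝ)⁻¹ * fraktRow D d := fun d _ =>
    mul_nonneg (inv_nonneg.mpr (Nat.cast_nonneg d))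
      (Finset.sum_nonneg fun l _ => div_nonneg (frakt_nonneg _ _) (Nat.cast_nonneg l))
  have hsub : (Finset.Icc 2 M).biUnion W ⊆ (Finset.Icc 1 N).filter
      (fun d : ℕ => bigP D ^ (0.5 : ℝ) * (etaPM D 1 - etaPM D (-1)) < d) :=
    Finset.biUnion_subset.mpr hWsub
  have hlog : (1286 / 100 : ℝ) ≤ ∑ l ∈ Finset.Icc 2 M, (l : ℝ)⁻¹ := by
    have h := log_sub_one_le_sum_Icc_two (M := M) (by rw [hMdef]; norm_num)
    have hM' : Real.log ((2 : ℝ) ^ 20) ≤ Real.log ((M : ℝ) + 1) := by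
      apply Real.log_le_log (by norm_num); rw [hMdef]; norm_num
    have h20 : Real.log ((2 : ℝ) ^ 20) = 20 * Real.log 2 := by
      rw [Real.log_pow]; norm_num
    have h2 := Real.log_two_gt_d9
    calc (1286 / 100 : ℝ) ≤ 20 * Real.log 2 - 1 := by linarith
      _ ≤ Real.log ((M : ℝ) + 1) - 1 := by linarith
      _ ≤ _ := h
  have hMB : ((M : ℝ) - 1) / B ≤ (54 / 100) * x := by
    -- `B ≥ A ≥ 𝓛¹⁹` and `M/𝓛¹⁹ = x·M/𝓛⁹ ≤ 0.54x`
    have hB19 : ell D ^ 19 ≤ B := le_trans hA19 hAB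
    have h9 : (1953125 : ℝ) ≤ ell D ^ 9 := by
      calc (1953125 : ℝ) = 5 ^ 9 := by norm_num
        _ ≤ ell D ^ 9 := pow_le_pow_left₀ (by norm_num) hL 9
    calc ((M : ℝ) - 1) / B ≤ (M : ℝ) / ell D ^ 19 := by
          rw [div_le_div_iff₀ hB0 (by positivity)]
          nlinarith
      _ = x * ((M : ℝ) / ell D ^ 9) := by rw [hxdef]; field_simp
      _ ≤ x * (54 / 100) := by
          apply mul_le_mul_of_nonneg_left _ hx0.le
          rw [div_le_iff₀ (by positivity), hMdef]; push_cast; nlinarith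
      _ = (54 / 100) * x := by ring
  calc 24 * (ell D ^ 10)⁻¹ = 24 * x := by rw [hxdef]
    _ ≤ (199 / 100) * x * (1286 / 100) - (54 / 100) * x := by nlinarith
    _ ≤ (B - A) / B * (∑ l ∈ Finset.Icc 2 M, (l : ℝ)⁻¹) - ((M : ℝ) - 1) / B := by
        have h1 : (199 / 100) * x * (1286 / 100) ≤ (B - A) / B * ∑ l ∈ Finset.Icc 2 M, (l : ℝ)⁻¹ :=
          mul_le_mul hfrac hlog (by norm_num) (div_nonneg (by linarith) hB0.le)
        linarith
    _ = ∑ l ∈ Finset.Icc 2 M, ((B - A) / l - 1) * B⁻¹ := by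
        have hc : ((Finset.Icc 2 M).card : ℝ) = (M : ℝ) - 1 := by
          rw [Nat.card_Icc, Nat.cast_sub (by rw [hMdef]; norm_num)]; push_cast; ring
        have e1 : ∑ l ∈ Finset.Icc 2 M, ((B - A) / l - 1) * B⁻¹ =
            ∑ l ∈ Finset.Icc 2 M, ((B - A) / B * (l : ℝ)⁻¹ - B⁻¹) :=
          Finset.sum_congr rfl fun l _ => by ring
        rw [e1, Finset.sum_sub_distrib, Finset.sum_const, nsmul_eq_mul, hc, ← Finset.mul_sum]
        ring
    _ ≤ ∑ l ∈ Finset.Icc 2 M, ((W l).card : ℝ) * B⁻¹ :=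
        Finset.sum_le_sum fun l hl => mul_le_mul_of_nonneg_right (hcard l hl) (inv_nonneg.mpr hB0.le)
    _ = ∑ l ∈ Finset.Icc 2 M, ∑ d ∈ W l, B⁻¹ := by
        refine Finset.sum_congr rfl fun l _ => ?_
        rw [Finset.sum_const, nsmul_eq_mul]
    _ ≤ ∑ l ∈ Finset.Icc 2 M, ∑ d ∈ W l, (d : ℝ)⁻¹ * fraktRow D d :=
        Finset.sum_le_sum fun l hl => Finset.sum_le_sum fun d hd => hterm l hl d hd
    _ = ∑ d ∈ (Finset.Icc 2 M).biUnion W, (d : ℝ)⁻¹ * fraktRow D d :=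
        (Finset.sum_biUnion hWdisj).symm
    _ ≤ _ := Finset.sum_le_sum_of_subset_of_nonneg hsub fun d hd _ => hnn d hd

/-- **The printed first display of `Z22:§12.u008` (no square) is FALSE for `𝓛 ≥ 5`**: its right side
is `≤ 10𝓛⁻¹⁰` (`sum_inv_sq_mul_fraktCol_le`) while its left side is `≥ 24𝓛⁻¹⁰`
(`fraktDoubleSum_printed_lhs_ge`). [cite: Zhang2022LandauSiegel, §12 p.67, tex L3421–L3423] -/
theorem fraktDoubleSum_printed_ineq_false {D : ℕ} (hL : 5 ≤ ell D) :
    ¬ (∑ d ∈ (Finset.Icc 1 (fraktN D)).filter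
          (fun d : ℕ => bigP D ^ (0.5 : ℝ) * (etaPM D 1 - etaPM D (-1)) < d),
        (d : ℝ)⁻¹ * fraktRow D d ≤
      ∑ l ∈ Finset.Icc 1 (fraktN D), ((l : ℝ) ^ 2)⁻¹ * fraktCol D l) := by
  intro h
  have h1 := fraktDoubleSum_printed_lhs_ge hL
  have h2 := sum_inv_sq_mul_fraktCol_le (D := D) (by linarith)
  have hx : 0 < (ell D ^ 10)⁻¹ := inv_pos.mpr (pow_pos (by linarith) 10)
  linarith

open Literature.NumberTheory.EllipticCurves.ModularForms in
/-- **`Typed.Sec12A.FraktDoubleSum` AS TYPED (= the printed pair of displays, the first WITHOUT the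
square) is false** — kernel refutation (GAP-LEDGER G-d42-1, class printed-false-pointwise): for
every threshold there is an odd prime `p` above it (carrying the quadratic primitive character
`(·/p) ⊗ ℂ`) with `log p ≥ 5`, where the first conjunct fails (`fraktDoubleSum_printed_ineq_false`).
The REPAIRED node `fraktDoubleSum_repaired` (inner sum squared) holds; nothing here concerns (12.6),
Theorems 1–2 or Landau–Siegel zeros. [cite: Zhang2022LandauSiegel, §12 p.67, tex L3421–L3423] -/
theorem not_fraktDoubleSum : ¬ FraktDoubleSum := by
  rintro ⟨C, D₀, hAll⟩
  obtain ⟨p, hpge, hp⟩ := Nat.exists_infinite_primes (max D₀ (⌈Real.exp 5⌉₊ + 3))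
  haveI : Fact p.Prime := ⟨hp⟩
  have hpD₀ : D₀ ≤ p := le_trans (le_max_left _ _) hpge
  have hp5 : ⌈Real.exp 5⌉₊ ≤ p := le_trans (by omega) (le_trans (le_max_right _ _) hpge)
  have hL : 5 ≤ ell p := le_ell_of_ceil_exp_le hp5
  have hp2 : p ≠ 2 := by
    have : 3 ≤ p := le_trans (by omega) (le_trans (le_max_right _ _) hpge)
    omega
  haveI : NeZero p := ⟨hp.ne_zero⟩
  have h := hAll p ((quadraticChar (ZMod p)).ringHomComp (Int.castRingHom ℂ)) hpD₀
    (isQuadratic_quadraticChar_ringHomComp p) (isPrimitive_quadraticChar_ringHomComp p hp2)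
  exact fraktDoubleSum_printed_ineq_false hL h.1

/-! ## The `1/l`-reading of the first display: `≪ 𝓛⁻¹⁰·log 𝓛` (L3 LEDGER #10 (2)) -/

/-- **`Z22:§12.u008`, first display, CORRECTED in the `1/l`-reading** (sz-d60 / L3 LEDGER #10 (2):
the printed weight `l⁻²` read as the slip it must be; the true size of the printed LEFT side): for
`𝓛 = log D ≥ 4`, `Σ_{d>P^{0.5}(η₊−η₋)} d⁻¹(Σ_l 𝔱(dl)/l) ≤ 40·𝓛⁻¹⁰(1 + log 𝓛)` — only `l < B/δ ≤ 𝓛¹⁰`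
contribute (`dl ≤ B`, `d > δ = B − A ≥ B𝓛⁻¹⁰`), each column sum is `≤ (B−A)/A + l/A` (`fraktCol_le`),
`Σ_{l≤𝓛¹⁰} l⁻¹ ≤ 1 + 10 log 𝓛`, and `𝓛¹⁰/A ≤ 𝓛⁻¹¹` (`A ≥ 𝓛²¹` for `𝓛 ≥ 4`). Together with
`fraktDoubleSum_printed_lhs_ge` (`≥ 24𝓛⁻¹⁰` for `𝓛 ≥ 5`; indeed `≍ 𝓛⁻¹⁰log 𝓛`) this pins the
left side down: the printed final `≪ 𝓛⁻¹⁰` is short by a factor `≍ log 𝓛`, harmless wherever only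
`o(1)` is consumed. [cite: Zhang2022LandauSiegel, §12 p.67, tex L3421–L3423] -/
theorem fraktDoubleSum_corrected :
    ∃ C : ℝ, ForAllLarge fun D _ _ =>
      ∑ d ∈ (Finset.Icc 1 (fraktN D)).filter
          (fun d : ℕ => bigP D ^ (0.5 : ℝ) * (etaPM D 1 - etaPM D (-1)) < d),
        (d : ℝ)⁻¹ * fraktRow D d ≤ C * (ell D ^ 10)⁻¹ * (1 + Real.log (ell D)) := by
  refine ⟨40, ⌈Real.exp 4⌉₊, fun D _ _ hD _ _ => ?_⟩
  have hL : 4 ≤ ell D := le_ell_of_ceil_exp_le hD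
  have hL2 : 2 ≤ ell D := by linarith
  have hℓ0 : 0 < ell D := by linarith
  obtain ⟨hA0, hAB, hratio, -, -⟩ := window_params hL2
  set Q : ℝ := bigP D ^ (0.5 : ℝ) with hQdef
  set A : ℝ := Q * etaPM D (-1) with hAdef
  set B : ℝ := Q * etaPM D 1 with hBdef
  set N : ℕ := fraktN D with hNdef
  set x : ℝ := (ell D ^ 10)⁻¹ with hxdef
  set F : Finset ℕ := (Finset.Icc 1 N).filter
    (fun d : ℕ => bigP D ^ (0.5 : ℝ) * (etaPM D 1 - etaPM D (-1)) < d) with hFdef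
  have hB0 : 0 < B := lt_of_lt_of_le hA0 hAB
  have hQpos : 0 < Q := by rw [hQdef]; exact Real.rpow_pos_of_pos (Real.exp_pos _) _
  have hx0 : 0 < x := by rw [hxdef]; positivity
  have h10 : (1048576 : ℝ) ≤ ell D ^ 10 := by
    calc (1048576 : ℝ) = 4 ^ 10 := by norm_num
      _ ≤ ell D ^ 10 := pow_le_pow_left₀ (by norm_num) hL 10
  have hx1 : x ≤ 1 / 1048576 := by
    rw [hxdef]; exact inv_le_of_inv_le₀ (by norm_num) (by rw [inv_div]; simpa using h10)
  have hxL : x * ell D ^ 10 = 1 := by rw [hxdef]; field_simp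
  -- `η_± = e^{±x}`, `B = A e^{2x}`, `Bx ≤ B − A`
  have hηm_eq : etaPM D (-1) = Real.exp (-x) := by rw [etaPM, hxdef]; ring_nf
  have hηp_eq : etaPM D 1 = Real.exp x := by rw [etaPM, hxdef]; ring_nf
  have hBA : B = A * Real.exp (2 * x) := by
    rw [hAdef, hBdef, hηm_eq, hηp_eq, mul_assoc, ← Real.exp_add]; ring_nf
  have hBx : B * x ≤ B - A := by
    -- `A = B e^{−2x} ≤ B/(1+2x)` and `1 − 1/(1+2x) ≥ x`
    have h1 : A * (1 + 2 * x) ≤ B := by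
      rw [hBA]; exact mul_le_mul_of_nonneg_left (by linarith [Real.add_one_le_exp (2 * x)]) hA0.le
    nlinarith
  -- `A ≥ 𝓛²¹` (for `𝓛 ≥ 4`)
  have hA21 : ell D ^ 21 ≤ A := by
    have hηhalf : (1 : ℝ) / 2 ≤ etaPM D (-1) := by
      rw [hηm_eq]; have := Real.add_one_le_exp (-x); linarith
    have hQ : Q = Real.exp (ell D ^ 9 * 0.5) := by rw [hQdef, bigP, Real.exp_mul]
    have hQlow : (ell D ^ 9 * 0.5) ^ 3 / 6 ≤ Q := by
      rw [hQ]
      have := Real.pow_div_factorial_le_exp (x := ell D ^ 9 * 0.5) (by positivity) 3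
      simpa [Nat.factorial] using this
    have h6 : (4096 : ℝ) ≤ ell D ^ 6 := by
      calc (4096 : ℝ) = 4 ^ 6 := by norm_num
        _ ≤ ell D ^ 6 := pow_le_pow_left₀ (by norm_num) hL 6
    calc ell D ^ 21 ≤ (ell D ^ 9 * 0.5) ^ 3 / 6 * (1 / 2) := by
          have : (ell D ^ 9 * 0.5) ^ 3 / 6 * (1 / 2) = ell D ^ 21 * (ell D ^ 6 / 96) := by ring
          rw [this]
          have hℓ21 : 0 ≤ ell D ^ 21 := by positivity
          nlinarith
      _ ≤ Q * etaPM D (-1) := by gcongr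
  -- nonnegativity of the summands
  have hsummand_nn : ∀ d l : ℕ, 0 ≤ (d : ℝ)⁻¹ * (frakt D ((d * l : ℕ) : ℝ) / (l : ℝ)) := fun d l =>
    mul_nonneg (inv_nonneg.mpr (Nat.cast_nonneg d)) (div_nonneg (frakt_nonneg _ _) (Nat.cast_nonneg l))
  -- vanishing of the columns with `l > 𝓛¹⁰` on `F`
  have hvanish : ∀ l ∈ Finset.Icc 1 N, ¬ ((l : ℝ) ≤ ell D ^ 10) → ∀ d ∈ F,
      (d : ℝ)⁻¹ * (frakt D ((d * l : ℕ) : ℝ) / (l : ℝ)) = 0 := by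
    intro l _ hl d hd
    rcases frakt_eq_zero_or_one D ((d * l : ℕ) : ℝ) with h0 | h1
    · rw [h0, zero_div, mul_zero]
    · exfalso
      obtain ⟨-, hB'⟩ := window_of_frakt_eq_one h1
      push_cast at hB'
      have hdδ : B - A < d := by
        have := (Finset.mem_filter.mp hd).2
        have e : bigP D ^ (0.5 : ℝ) * (etaPM D 1 - etaPM D (-1)) = B - A := by
          rw [hAdef, hBdef, hQdef]; ring
        linarith
      have hl' : ell D ^ 10 < l := lt_of_not_ge hl
      have hd0 : (0 : ℝ) ≤ d := Nat.cast_nonneg d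
      -- `B x 𝓛¹⁰ = B`, `(B − A) l ≤ d l ≤ B` contradiction
      have e1 : (B - A) * l < (d : ℝ) * l := mul_lt_mul_of_pos_right hdδ (by linarith)
      have e2 : B * x * ell D ^ 10 < (B - A) * l := by
        calc B * x * ell D ^ 10 = B * x * ell D ^ 10 := rfl
          _ < B * x * l := mul_lt_mul_of_pos_left hl' (mul_pos hB0 hx0)
          _ ≤ (B - A) * l := mul_le_mul_of_nonneg_right hBx (by linarith)
      rw [mul_assoc, hxL, mul_one] at e2
      have hB'' : (d : ℝ) * l ≤ B := hB'
      linarith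
  -- the main chain
  set K : ℕ := ⌊ell D ^ 10⌋₊ with hKdef
  have hKle : (K : ℝ) ≤ ell D ^ 10 := Nat.floor_le (by positivity)
  have hFsub : F ⊆ Finset.Icc 1 N := Finset.filter_subset _ _
  calc ∑ d ∈ F, (d : ℝ)⁻¹ * fraktRow D d
      = ∑ d ∈ F, ∑ l ∈ Finset.Icc 1 N, (d : ℝ)⁻¹ * (frakt D ((d * l : ℕ) : ℝ) / (l : ℝ)) := by
        refine Finset.sum_congr rfl fun d _ => ?_
        rw [fraktRow, Finset.mul_sum]
    _ = ∑ l ∈ Finset.Icc 1 N, ∑ d ∈ F, (d : ℝ)⁻¹ * (frakt D ((d * l : ℕ) : ℝ) / (l : ℝ)) :=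
        Finset.sum_comm
    _ = ∑ l ∈ (Finset.Icc 1 N).filter (fun l : ℕ => (l : ℝ) ≤ ell D ^ 10),
          ∑ d ∈ F, (d : ℝ)⁻¹ * (frakt D ((d * l : ℕ) : ℝ) / (l : ℝ)) := by
        rw [Finset.sum_filter]
        refine Finset.sum_congr rfl fun l hl => ?_
        split_ifs with h
        · rfl
        · exact Finset.sum_eq_zero (hvanish l hl h)
    _ ≤ ∑ l ∈ Finset.Icc 1 K, ∑ d ∈ Finset.Icc 1 N,
          (d : ℝ)⁻¹ * (frakt D ((d * l : ℕ) : ℝ) / (l : ℝ)) := by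
        have hsub : (Finset.Icc 1 N).filter (fun l : ℕ => (l : ℝ) ≤ ell D ^ 10) ⊆ Finset.Icc 1 K := by
          intro l hl
          rw [Finset.mem_filter, Finset.mem_Icc] at hl
          exact Finset.mem_Icc.mpr ⟨hl.1.1, Nat.le_floor hl.2⟩
        refine le_trans (Finset.sum_le_sum fun l _ =>
          Finset.sum_le_sum_of_subset_of_nonneg hFsub fun d _ _ => hsummand_nn d l) ?_
        exact Finset.sum_le_sum_of_subset_of_nonneg hsub fun l _ _ =>
          Finset.sum_nonneg fun d _ => hsummand_nn d l
    _ = ∑ l ∈ Finset.Icc 1 K, (l : ℝ)⁻¹ * fraktCol D l := by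
        refine Finset.sum_congr rfl fun l _ => ?_
        rw [fraktCol, Finset.mul_sum]
        refine Finset.sum_congr rfl fun d _ => ?_
        ring
    _ ≤ ∑ l ∈ Finset.Icc 1 K, ((B - A) / A * (l : ℝ)⁻¹ + A⁻¹) := by
        refine Finset.sum_le_sum fun l hl => ?_
        have hl1 : 1 ≤ l := (Finset.mem_Icc.mp hl).1
        have hl1' : (1 : ℝ) ≤ l := by exact_mod_cast hl1
        calc (l : ℝ)⁻¹ * fraktCol D l ≤ (l : ℝ)⁻¹ * ((B - A) / A + l / A) :=
              mul_le_mul_of_nonneg_left (fraktCol_le hA0 hAB hl1) (by positivity)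
          _ = (B - A) / A * (l : ℝ)⁻¹ + A⁻¹ := by field_simp
    _ = (B - A) / A * (∑ l ∈ Finset.Icc 1 K, (l : ℝ)⁻¹) + (K : ℝ) * A⁻¹ := by
        rw [Finset.sum_add_distrib, ← Finset.mul_sum, Finset.sum_const, nsmul_eq_mul, Nat.card_Icc]
        simp
    _ ≤ 4 * x * (1 + 10 * Real.log (ell D)) + x := by
        have h1 : ∑ l ∈ Finset.Icc 1 K, (l : ℝ)⁻¹ ≤ 1 + 10 * Real.log (ell D) := by
          refine le_trans (sum_Icc_inv_le_one_add_log K) ?_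
          rcases Nat.eq_zero_or_pos K with h0 | hpos
          · rw [h0, Nat.cast_zero, Real.log_zero]
            linarith [Real.log_nonneg (show (1 : ℝ) ≤ ell D by linarith)]
          · have : Real.log K ≤ Real.log (ell D ^ 10) :=
              Real.log_le_log (by exact_mod_cast hpos) hKle
            rw [Real.log_pow] at this
            push_cast at this
            linarith
        have h2 : (K : ℝ) * A⁻¹ ≤ x := by
          -- `K/A ≤ 𝓛¹⁰/𝓛²¹ = x/𝓛 ≤ x`
          rw [← div_eq_mul_inv, div_le_iff₀ hA0]
          have hℓ11 : ell D ^ 10 ≤ x * ell D ^ 21 := by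
            rw [hxdef]
            rw [show (ell D ^ 10 : ℝ)⁻¹ * ell D ^ 21 = ell D ^ 11 by field_simp]
            exact pow_le_pow_right₀ (by linarith) (by norm_num)
          nlinarith
        have hlog0 : 0 ≤ 1 + 10 * Real.log (ell D) := by
          linarith [Real.log_nonneg (show (1 : ℝ) ≤ ell D by linarith)]
        have h3 : (B - A) / A * ∑ l ∈ Finset.Icc 1 K, (l : ℝ)⁻¹ ≤ 4 * x * (1 + 10 * Real.log (ell D)) :=
          mul_le_mul hratio h1 (Finset.sum_nonneg fun l _ => by positivity) (by positivity)
        linarith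
    _ ≤ 40 * (ell D ^ 10)⁻¹ * (1 + Real.log (ell D)) := by
        rw [← hxdef]
        nlinarith [Real.log_nonneg (show (1 : ℝ) ≤ ell D by linarith)]

end Literature.NumberTheory.LFunctions.Zhang2022.Typed.Sec12A

end
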